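import Summits.ResolutionOfSingularities.ResolutionOfSingularities.Theorems.HilbertSamuelEliminationSigmaMaxModificationsCorridor3WLadderPsiShift
import Summits.ResolutionOfSingularities.ResolutionOfSingularities.Theorems.HilbertSamuelEliminationSigmaMaxModificationsCorridor3WLadderAlgIsolatedBricks
import Summits.ResolutionOfSingularities.ResolutionOfSingularities.Theorems.HilbertSamuelEliminationSigmaMaxModificationsCorridor3WLadderIsoTailsHSArc
import Literature.RingTheory.HilbertSamuel.HilbertSamuelCompletionPsi
import Literature.AlgebraicGeometry.Resolution.GRingAdicCompletionRegularHom
import Literature.AlgebraicGeometry.Resolution.ExcellentRingsCompleteHolds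
import Literature.AlgebraicGeometry.Resolution.AdicCompletionRegular
import Literature.AlgebraicGeometry.CossartJannsenSaito2020.KeyTheoremsIsolated
import Mathlib.RingTheory.AdicCompletion.LocalRing
import HarnessLib

/-!
# [OURS · L1 W4.2] D14 ROUTE H — object H8: isolation in the Hilbert–Samuel locus passes to the completion

Corridor-3 W-ladder (crux `SigmaMaxModifications`, stmt-ResolutionOfSingularities-18506 / conjunct
stmt-ResolutionOfSingularities-19249), D14 ROUTE H of res-L1-w42-lead-1 (`D14-BRIDGE-CUT.md`, row H8),
dealt to res-D-pv-010 by res-L1-w42-plan-1 (RULINGS v3.14-7). HELPER file (`--supports stmt-…-19249`): it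
closes no item, asserts nothing of [Hironaka2017], imports no `Theses` file, introduces no definition.

## What is proved

For a noetherian local ring `A` with `𝔪`-adic completion `Â = AdicCompletion (maximalIdeal A) A`:

* (in the companion file `…Corridor3WLadderPsiShift`) `minimalPrimesCodim_localization_eq_add` — **ψ-SHIFT**
  (the `ψ`-half of CJS (2.13), in ring form): for a flat homomorphism `A → B` of catenary noetherian local
  rings such that every minimal prime `𝔮` of `B` contracts to a minimal prime of `A` with
  `dim B/𝔮 = dim A/(𝔮 ∩ A)`, and a prime `Q` of `B` over `q = Q ∩ A`:  `ψ(B_Q) = ψ(A_q) + dim (B_Q / q B_Q)`.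
* `hsFun_spec_eq_of_isRegularHom`, `isIsolatedInHSMaxLocus_of_isRegularHom` — the GENERAL forms (asked for
  by res-L1-w42-lead-1, 10:47:59Z): along a regular homomorphism `A → B` of catenary noetherian local rings
  whose minimal primes descend with their codimensions (`hmin`), `H^N_{Spec B}(𝔔) = H^N_{Spec A}(𝔔 ∩ A)` at
  every prime `𝔔` of `B` for `N ≥ dim B`; if moreover `A → B` is local with `𝔪_B` the only prime over
  `𝔪_A`, isolation of the closed point in the `H^N`-maximal locus ascends from `Spec A` to `Spec B`.
* `hsFun_spec_adicCompletion_eq` — **H8a: `H^N_{Spec Â}(𝔓) = H^N_{Spec A}(𝔓 ∩ A)` at EVERY prime `𝔓` of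
  `Â`** (CJS Lemma 2.37 (2), (2.13)–(2.14), for `X = X₀ = Spec A`, `x₀ = 𝔪`), for `A` excellent whose
  quotients `A/𝔮` by minimal primes are formally equidimensional (hypothesis `hFE`, see below) and every
  level `N ≥ dim A` (`isRegularHom_catenary_minimalPrimes_adicCompletion` supplies the data of the general
  form for `B = Â`).
* `isIsolatedInHSMaxLocus_adicCompletion` — **H8b (the dealt statement): if the closed point of `Spec A` is
  isolated in the `H^N`-maximal locus, so is the closed point of `Spec Â`** — indeed
  `Σ^{max}(Spec Â) = {𝔪̂}`.
* `hsFun_spec_adicCompletion_eq_of_ringEquiv`, `isIsolatedInHSMaxLocus_adicCompletion_of_ringEquiv` — the same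
  two statements with `hFE` DISCHARGED for `A ≅ S/I`, `S` regular local, `I` any ideal (the hypersurface
  cell `A = R/(h)` of ROUTE H), by `formallyEquidimensional_quotient_minimalPrimes_of_ringEquiv`.

## Proof (CJS (2.13) at every point of `Spec B`, `B = Â`; no Bennett / Lemma 3.4, no strictness `ψ < N`)

`A → Â` is a regular homomorphism (`A` is a G-ring: `IsGRing.isRegularHom_adicCompletion_ideal`), flat
and local. For a prime `𝔓` of `Â` over `𝔭 = 𝔓 ∩ A`, the local homomorphism `A_𝔭 → Â_𝔓` is flat with
geometrically regular closed fibre, of dimension `d` say, so `H^{(t+d)}(Â_𝔓) = H^{(t)}(A_𝔭)` (H-SHIFT,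
res-D-pv-042's `hilbertSamuelFun_localization_eq_of_isRegularHom`, resting on `FlatRegularFibreHilbert`),
and `ψ(Â_𝔓) = ψ(A_𝔭) + d` (ψ-SHIFT, `…Corridor3WLadderPsiShift`). The ψ-shift is elementary dimension bookkeeping: for
every minimal prime `𝔔 ⊆ 𝔓` of `Â`, catenarity of `A` and `Â` and `dim Â/𝔔 = dim A/(𝔔 ∩ A)` (`hFE`,
through `ringKrullDim_quotient_eq_of_mem_minimalPrimes_adicCompletion`) give the value formula
`dim(Â_𝔓/𝔔) + dim Â/𝔓 = dim(A_𝔭/(𝔔 ∩ A)) + dim A/𝔭`; the flat dimension formula for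
`A_𝔭/𝔮₁ A_𝔭 → Â_𝔓/𝔮₁ Â_𝔓` (`𝔮₁ ⊆ 𝔭` minimal) and going down produce one minimal `𝔔₁` with
`dim A/𝔭 = dim Â/𝔓 + d`; the two minima defining `ψ` are then compared through contraction and going
down. Since `ψ(Â_𝔓) ≤ dim Â = dim A ≤ N`, no truncation occurs and `H^N_{Spec Â}(𝔓) = H^N_{Spec A}(𝔭)`
(`hsFun_Spec_eq`, res-type-001). Finally `A → Â` is faithfully flat, so `Spec Â → Spec A` is surjective and
both schemes have the same set of values of `H^N`; hence `𝔓 ∈ Σ^{max}(Spec Â) ⇔ 𝔓 ∩ A ∈ Σ^{max}(Spec A)`.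
On the local scheme `Spec A` every point specialises to `𝔪`, so isolation of `𝔪` forces
`Σ^{max}(Spec A) = {𝔪}`, and therefore `Σ^{max}(Spec Â) = {𝔓 : 𝔓 ∩ A = 𝔪} = {𝔪̂}` (`𝔪Â = 𝔪̂`).

## Hypotheses, honestly

* `hA : IsExcellentRing A` — used only through `IsGRing A` (regularity of `A → Â`) and `IsCatenaryRing A`.
* `hFE` — formal equidimensionality of the `A/𝔮`, `𝔮` minimal: every minimal prime `P'` of `(A/𝔮)^` has
  `dim (A/𝔮)^/P' = dim A/𝔮`. For universally catenary (e.g. excellent) `A` this holds by Ratliff's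
  theorem [Matsumura1987, Thm. 31.7], which the tree does not contain; it is therefore KEPT as a hypothesis
  and discharged only for quotients of regular local rings (`…_of_ringEquiv`), which covers ROUTE H.
* `hN : ringKrullDim A ≤ N` — the level is at least the dimension (CJS take `N = dim X`), so that
  `H^N = H^{(N − ψ)}` involves no truncated subtraction on either side.

## Credits

H-shift: res-D-pv-042 (`…Corridor3WLadderAlgIsolatedBricks`); `hsFun_Spec_eq`: res-type-001
(`…Corridor3WLadderIsoTailsHSArc`); `ψ(Â) = ψ(A)` at the closed point and the `hFE` technology:
`Literature.RingTheory.HilbertSamuel.HilbertSamuelCompletionPsi`; the cut: res-L1-w42-lead-1, D14-BRIDGE-CUT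
row H8. Author: res-D-pv-010 (HIRONAKA-L D lane, W4.2).

## References

* V. Cossart, U. Jannsen, S. Saito, *Desingularization: invariants and strategy*, LNM 2270 (2020),
  Def. 2.28, Lemma 2.37 (2) ((2.13)–(2.14)), Claim 2.40. [CossartJannsenSaito2020]
* H. Matsumura, *Commutative Ring Theory* (1986), Thm. 15.1 (dimension formula for flat local
  homomorphisms), §31 (Ratliff). [Matsumura1987]
-/

noncomputable section

set_option linter.dupNamespace false

open IsLocalRing AlgebraicGeometry
open Literature.AlgebraicGeometry.Resolution Literature.RingTheory.HilbertSamuel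
open Literature.AlgebraicGeometry.CossartJannsenSaito2020
open Summit.ResolutionOfSingularities.ResolutionOfSingularities.Theorems.SigmaMaxModificationsCorridor3.IsoTailsHS (hsFun_Spec_eq)

universe u

namespace Summit.ResolutionOfSingularities.ResolutionOfSingularities.Cruxes.SigmaMaxModifications.IdeasL1C4

section RegularHom

variable {A B : Type u} [CommRing A] [CommRing B] [Algebra A B] [IsNoetherianRing A] [IsNoetherianRing B]
  [IsLocalRing A] [IsLocalRing B]

/-- **H8a, general form — `H^N_{Spec B}(𝔔) = H^N_{Spec A}(𝔔 ∩ A)` at EVERY prime `𝔔` of `B` along a regular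
homomorphism `A → B` of catenary noetherian local rings whose minimal primes descend with their
codimensions** (`hmin`: every minimal prime `𝔮` of `B` contracts to a minimal prime of `A` with
`dim B/𝔮 = dim A/(𝔮 ∩ A)`), at every level `N ≥ dim B` (no truncation). Proof: H-shift
`H^{(t+d)}(B_𝔔) = H^{(t)}(A_𝔮)` (`hilbertSamuelFun_localization_eq_of_isRegularHom`, res-D-pv-042) and ψ-shift
`ψ(B_𝔔) = ψ(A_𝔮) + d` (`minimalPrimesCodim_localization_eq_add`), `d` the dimension of the closed fibre of
`A_𝔮 → B_𝔔`, read through `hsFun_Spec_eq`; `ψ(B_𝔔) ≤ dim B ≤ N`. This is CJS (2.13)–(2.14) with `Spec B` in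
place of `X̂`. [OURS · L1 W4.2] [cite: CossartJannsenSaito2020, Lemma 2.37 (2), (2.13)–(2.14)] -/
theorem hsFun_spec_eq_of_isRegularHom (hreg : IsRegularHom A B) (hcatA : IsCatenaryRing A)
    (hcatB : IsCatenaryRing B)
    (hmin : ∀ 𝔮 ∈ minimalPrimes B, 𝔮.under A ∈ minimalPrimes A ∧
      ringKrullDim (B ⧸ 𝔮) = ringKrullDim (A ⧸ 𝔮.under A))
    (N : ℕ) (hN : ringKrullDim B ≤ N) (x : ↥(Spec (CommRingCat.of B))) :
    Scheme.hsFun (Spec (CommRingCat.of B)) N x =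
      Scheme.hsFun (Spec (CommRingCat.of A)) N ⟨x.asIdeal.comap (algebraMap A B), inferInstance⟩ := by
  classical
  haveI : Module.Flat A B := hreg.1
  -- the prime and its contraction
  set Q : Ideal B := x.asIdeal with hQ
  set q : Ideal A := Q.comap (algebraMap A B) with hq
  -- the closed fibre of `A_q → B_Q` has some finite dimension `d`
  haveI : IsLocalHom (Localization.localRingHom q Q (algebraMap A B) hq) :=
    Localization.isLocalHom_localRingHom q Q (algebraMap A B) hq
  have hne : (maximalIdeal (Localization.AtPrime q)).map
      (Localization.localRingHom q Q (algebraMap A B) hq) ≠ ⊤ :=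
    fun htop => (maximalIdeal.isMaximal (Localization.AtPrime Q)).ne_top
      (top_le_iff.mp (htop ▸ ((IsLocalRing.local_hom_TFAE _).out 0 2).mp ‹_›))
  obtain ⟨d, hd⟩ : ∃ d : ℕ, ringKrullDim (Localization.AtPrime Q ⧸
      (maximalIdeal (Localization.AtPrime q)).map (Localization.localRingHom q Q (algebraMap A B) hq)) = d := by
    haveI : Nontrivial (Localization.AtPrime Q ⧸
        (maximalIdeal (Localization.AtPrime q)).map (Localization.localRingHom q Q (algebraMap A B) hq)) :=
      Ideal.Quotient.nontrivial_iff.mpr hne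
    haveI : IsLocalRing (Localization.AtPrime Q ⧸
        (maximalIdeal (Localization.AtPrime q)).map (Localization.localRingHom q Q (algebraMap A B) hq)) :=
      IsLocalRing.of_surjective' (Ideal.Quotient.mk _) Ideal.Quotient.mk_surjective
    exact exists_nat_cast_eq_ringKrullDim
  -- H-shift (res-D-pv-042) and ψ-shift
  have hH := hilbertSamuelFun_localization_eq_of_isRegularHom hreg Q q hq hd
  have hψ := minimalPrimesCodim_localization_eq_add hcatA hcatB hmin Q q hq hd
  -- no truncation: `ψ(B_Q) ≤ dim B_Q ≤ dim B ≤ N`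
  have hψle : minimalPrimesCodim (Localization.AtPrime Q) ≤ N := by
    have h1 : (minimalPrimesCodim (Localization.AtPrime Q) : WithBot ℕ∞) ≤
        ringKrullDim (Localization.AtPrime Q) :=
      minimalPrimesCodim_le_ringKrullDim _
    have h2 : ringKrullDim (Localization.AtPrime Q) ≤ ringKrullDim B := by
      rw [IsLocalization.AtPrime.ringKrullDim_eq_height Q (Localization.AtPrime Q)]
      exact Ideal.height_le_ringKrullDim_of_isPrime
    have : (minimalPrimesCodim (Localization.AtPrime Q) : WithBot ℕ∞) ≤ (N : WithBot ℕ∞) :=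
      h1.trans (h2.trans hN)
    exact_mod_cast this
  rw [hsFun_Spec_eq N x (Localization.AtPrime Q),
    hsFun_Spec_eq N (⟨q, inferInstance⟩ : ↥(Spec (CommRingCat.of A))) (Localization.AtPrime q), hψ, hH]
  congr 1
  omega

/-- **H8b, general form — ISOLATION IN THE `H^N`-MAXIMAL LOCUS ASCENDS ALONG A REGULAR LOCAL HOMOMORPHISM
WITH ONE-POINT CLOSED FIBRE.** Let `A → B` be a regular LOCAL homomorphism of catenary noetherian local rings
with `hmin` as in `hsFun_spec_eq_of_isRegularHom`, `dim B ≤ N`, and assume the only prime of `B` over `𝔪_A`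
is `𝔪_B` (`hfib`). If the closed point of `Spec A` is isolated in the `H^N`-maximal locus, so is the closed
point of `Spec B` — indeed `Σ^{max}(Spec B) = {𝔪_B}`. Proof: by H8a (general) and faithful flatness both
schemes have the same set of values of `H^N`, and `𝔔 ∈ Σ^{max}(Spec B) ⇔ 𝔔 ∩ A ∈ Σ^{max}(Spec A)`; on the
local scheme `Spec A`, isolation of `𝔪_A` means `Σ^{max}(Spec A) = {𝔪_A}` (every point specialises to the
closed point), so `Σ^{max}(Spec B) = {𝔔 : 𝔔 ∩ A = 𝔪_A} = {𝔪_B}`. (The form asked for by res-L1-w42-lead-1,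
10:47:59Z, for `R/(h) → S/(g)`.) [OURS · L1 W4.2] [cite: CossartJannsenSaito2020, Lemma 2.37 (2), (2.13)–(2.14)] -/
theorem isIsolatedInHSMaxLocus_of_isRegularHom [IsLocalHom (algebraMap A B)] (hreg : IsRegularHom A B)
    (hcatA : IsCatenaryRing A) (hcatB : IsCatenaryRing B)
    (hmin : ∀ 𝔮 ∈ minimalPrimes B, 𝔮.under A ∈ minimalPrimes A ∧
      ringKrullDim (B ⧸ 𝔮) = ringKrullDim (A ⧸ 𝔮.under A))
    (N : ℕ) (hN : ringKrullDim B ≤ N)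
    (hfib : ∀ P : Ideal B, P.IsPrime → P.comap (algebraMap A B) = maximalIdeal A → P = maximalIdeal B)
    (h : IsIsolatedInHSMaxLocus (Spec (CommRingCat.of A)) N (closedPoint A)) :
    IsIsolatedInHSMaxLocus (Spec (CommRingCat.of B)) N (closedPoint B) := by
  classical
  haveI : Module.Flat A B := hreg.1
  -- the comparison map on points and its basic properties
  let c : ↥(Spec (CommRingCat.of B)) → ↥(Spec (CommRingCat.of A)) :=
    fun x => ⟨x.asIdeal.comap (algebraMap A B), inferInstance⟩
  have hH : ∀ x, Scheme.hsFun (Spec (CommRingCat.of B)) N x = Scheme.hsFun (Spec (CommRingCat.of A)) N (c x) :=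
    fun x => hsFun_spec_eq_of_isRegularHom hreg hcatA hcatB hmin N hN x
  -- faithful flatness: every prime of `A` is a contraction
  haveI : Module.FaithfullyFlat A B := Module.FaithfullyFlat.of_flat_of_isLocalHom
  have hsurj : ∀ P : ↥(Spec (CommRingCat.of A)), ∃ x, c x = P := by
    intro P
    obtain ⟨x, hx⟩ := PrimeSpectrum.comap_surjective_of_faithfullyFlat (A := A) (B := B) P
    exact ⟨x, PrimeSpectrum.ext (by rw [← hx]; rfl)⟩
  have hval : Scheme.hsValues (Spec (CommRingCat.of B)) N = Scheme.hsValues (Spec (CommRingCat.of A)) N := by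
    ext v
    constructor
    · rintro ⟨x, rfl⟩
      exact ⟨c x, (hH x).symm⟩
    · rintro ⟨P, rfl⟩
      obtain ⟨x, rfl⟩ := hsurj P
      exact ⟨x, hH x⟩
  have hcl : c (closedPoint B) = closedPoint A := by
    apply PrimeSpectrum.ext
    change (maximalIdeal B).comap (algebraMap A B) = maximalIdeal A
    exact IsLocalRing.maximalIdeal_comap _  -- `A → B` is a local homomorphism
  -- on the local scheme `Spec A`, isolation says `A_max = {𝔪}`
  obtain ⟨U, hU, hUeq⟩ := h
  have hmaxA : ∀ P : ↥(Spec (CommRingCat.of A)),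
      P ∈ Scheme.hsMaxLocus (Spec (CommRingCat.of A)) N → P = closedPoint A := by
    intro P hP
    have hcp : closedPoint A ∈ U := by
      have : closedPoint A ∈ U ∩ Scheme.hsMaxLocus (Spec (CommRingCat.of A)) N := by
        rw [hUeq]; exact Set.mem_singleton _
      exact this.1
    have hPU : P ∈ U := (IsLocalRing.specializes_closedPoint P).mem_open hU hcp
    have : P ∈ U ∩ Scheme.hsMaxLocus (Spec (CommRingCat.of A)) N := ⟨hPU, hP⟩
    rw [hUeq] at this
    exact this
  have hcpA : closedPoint A ∈ Scheme.hsMaxLocus (Spec (CommRingCat.of A)) N := by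
    have : closedPoint A ∈ U ∩ Scheme.hsMaxLocus (Spec (CommRingCat.of A)) N := by
      rw [hUeq]; exact Set.mem_singleton _
    exact this.2
  -- hence `B_max = {𝔪_B}`
  refine ⟨Set.univ, isOpen_univ, ?_⟩
  ext x
  simp only [Set.mem_inter_iff, Set.mem_univ, true_and, Set.mem_singleton_iff, Scheme.mem_hsMaxLocus_iff]
  constructor
  · intro hx
    -- `c x ∈ A_max`
    have hcx : c x ∈ Scheme.hsMaxLocus (Spec (CommRingCat.of A)) N := by
      rw [Scheme.mem_hsMaxLocus_iff]
      refine ⟨⟨c x, rfl⟩, fun v hv hle => ?_⟩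
      rw [← hval] at hv
      rw [← hH x] at hle ⊢
      exact hx.2 hv hle
    have hcx' := hmaxA _ hcx
    -- so `x ∩ A = 𝔪_A`, whence `x = 𝔪_B`
    apply PrimeSpectrum.ext
    have : (c x).asIdeal = (closedPoint A).asIdeal := by rw [hcx']
    exact hfib x.asIdeal x.2 this
  · rintro rfl
    refine ⟨⟨_, rfl⟩, fun v hv hle => ?_⟩
    rw [hval] at hv
    rw [hH, hcl] at hle ⊢
    exact ((Scheme.mem_hsMaxLocus_iff).mp hcpA).2 hv hle

end RegularHom

section Completion

variable (A : Type u) [CommRing A] [IsNoetherianRing A] [IsLocalRing A]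

/-- The data of `hsFun_spec_eq_of_isRegularHom` / `isIsolatedInHSMaxLocus_of_isRegularHom` for `A → Â`:
`A → Â` is a regular homomorphism (`A` is a G-ring), `A` and `Â` are catenary (`A` excellent; `Â` complete,
hence excellent), and the minimal primes of `Â` descend with their codimensions under `hFE`
(`ringKrullDim_quotient_eq_of_mem_minimalPrimes_adicCompletion`). [OURS · L1 W4.2]
[cite: CossartJannsenSaito2020, Lemma 2.37 (2) (proof, Claim 2.40)] -/
theorem isRegularHom_catenary_minimalPrimes_adicCompletion (hA : IsExcellentRing A)
    (hFE : ∀ q ∈ minimalPrimes A,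
      ∀ P' ∈ minimalPrimes (AdicCompletion ((maximalIdeal A).map (Ideal.Quotient.mk q)) (A ⧸ q)),
        ringKrullDim (AdicCompletion ((maximalIdeal A).map (Ideal.Quotient.mk q)) (A ⧸ q) ⧸ P') =
          ringKrullDim (A ⧸ q)) :
    IsRegularHom A (AdicCompletion (maximalIdeal A) A) ∧ IsCatenaryRing A ∧
      IsCatenaryRing (AdicCompletion (maximalIdeal A) A) ∧
      ∀ 𝔮 ∈ minimalPrimes (AdicCompletion (maximalIdeal A) A), 𝔮.under A ∈ minimalPrimes A ∧
        ringKrullDim (AdicCompletion (maximalIdeal A) A ⧸ 𝔮) = ringKrullDim (A ⧸ 𝔮.under A) :=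
  ⟨IsGRing.isRegularHom_adicCompletion_ideal (maximalIdeal A) hA.isQuasiExcellentRing.isGRing,
    hA.isUniversallyCatenaryRing.isCatenaryRing,
    (isExcellentRing_of_isAdicComplete (AdicCompletion (maximalIdeal A) A)).isUniversallyCatenaryRing.isCatenaryRing,
    fun _ h𝔮 => ringKrullDim_quotient_eq_of_mem_minimalPrimes_adicCompletion A hFE h𝔮⟩

/-- **H8a — `H^N_{Spec Â}(𝔓) = H^N_{Spec A}(𝔓 ∩ A)` at EVERY prime `𝔓` of the completion** (CJS Lemma
2.37 (2), (2.13)–(2.14), for `X = X₀ = Spec A`). Hypotheses: `A` excellent noetherian local (used: G-ring,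
catenary), `hFE` = formal equidimensionality of the quotients of `A` by its minimal primes (see the module
docstring; discharged for quotients of regular local rings in `hsFun_spec_adicCompletion_eq_of_ringEquiv`), and
`dim A ≤ N` (no truncation; `dim Â = dim A`). An instance of `hsFun_spec_eq_of_isRegularHom`.
[OURS · L1 W4.2] [cite: CossartJannsenSaito2020, Lemma 2.37 (2), (2.13)–(2.14)] -/
theorem hsFun_spec_adicCompletion_eq (hA : IsExcellentRing A)
    (hFE : ∀ q ∈ minimalPrimes A,
      ∀ P' ∈ minimalPrimes (AdicCompletion ((maximalIdeal A).map (Ideal.Quotient.mk q)) (A ⧸ q)),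
        ringKrullDim (AdicCompletion ((maximalIdeal A).map (Ideal.Quotient.mk q)) (A ⧸ q) ⧸ P') =
          ringKrullDim (A ⧸ q))
    (N : ℕ) (hN : ringKrullDim A ≤ N) (x : ↥(Spec (CommRingCat.of (AdicCompletion (maximalIdeal A) A)))) :
    Scheme.hsFun (Spec (CommRingCat.of (AdicCompletion (maximalIdeal A) A))) N x =
      Scheme.hsFun (Spec (CommRingCat.of A)) N
        ⟨x.asIdeal.comap (algebraMap A (AdicCompletion (maximalIdeal A) A)), inferInstance⟩ := by
  obtain ⟨hreg, hcatA, hcatB, hmin⟩ := isRegularHom_catenary_minimalPrimes_adicCompletion A hA hFE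
  exact hsFun_spec_eq_of_isRegularHom hreg hcatA hcatB hmin N ((ringKrullDim_adicCompletion A).le.trans hN) x

/-- **H8b — ISOLATION IN THE `H^N`-MAXIMAL LOCUS PASSES TO THE COMPLETION** (D14 ROUTE H, row H8): for an
excellent noetherian local ring `A` with `hFE` (formal equidimensionality of the `A/𝔮`, `𝔮` minimal) and
`dim A ≤ N`, if the closed point of `Spec A` is isolated in the `H^N`-maximal locus, then the closed point of
`Spec Â` is isolated in the `H^N`-maximal locus of `Spec Â`. An instance of
`isIsolatedInHSMaxLocus_of_isRegularHom`: `A → Â` is local and faithfully flat, and the only prime of `Â`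
over `𝔪` is `𝔪̂ = 𝔪Â` (`AdicCompletion.maximalIdeal_eq_map`). [OURS · L1 W4.2]
[cite: CossartJannsenSaito2020, Lemma 2.37 (2), (2.13)–(2.14)] -/
theorem isIsolatedInHSMaxLocus_adicCompletion (hA : IsExcellentRing A)
    (hFE : ∀ q ∈ minimalPrimes A,
      ∀ P' ∈ minimalPrimes (AdicCompletion ((maximalIdeal A).map (Ideal.Quotient.mk q)) (A ⧸ q)),
        ringKrullDim (AdicCompletion ((maximalIdeal A).map (Ideal.Quotient.mk q)) (A ⧸ q) ⧸ P') =
          ringKrullDim (A ⧸ q))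
    (N : ℕ) (hN : ringKrullDim A ≤ N)
    (h : IsIsolatedInHSMaxLocus (Spec (CommRingCat.of A)) N (closedPoint A)) :
    IsIsolatedInHSMaxLocus (Spec (CommRingCat.of (AdicCompletion (maximalIdeal A) A))) N
      (closedPoint (AdicCompletion (maximalIdeal A) A)) := by
  obtain ⟨hreg, hcatA, hcatB, hmin⟩ := isRegularHom_catenary_minimalPrimes_adicCompletion A hA hFE
  refine isIsolatedInHSMaxLocus_of_isRegularHom hreg hcatA hcatB hmin N
    ((ringKrullDim_adicCompletion A).le.trans hN) (fun P hP hPA => ?_) h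
  -- a prime of `Â` over `𝔪` contains `𝔪Â = 𝔪̂`, hence equals it
  have hle : maximalIdeal (AdicCompletion (maximalIdeal A) A) ≤ P := by
    rw [AdicCompletion.maximalIdeal_eq_map, Ideal.map_le_iff_le_comap]
    exact le_of_eq hPA.symm
  exact ((maximalIdeal.isMaximal _).eq_of_le hP.ne_top hle).symm

/-- **H8a with `hFE` discharged for quotients of regular local rings**: if `A ≅ S/I` with `S` regular local
(`I` any ideal — e.g. the hypersurface cell `A = R/(h)` of ROUTE H), `A` excellent and `dim A ≤ N`, then
`H^N_{Spec Â}(𝔓) = H^N_{Spec A}(𝔓 ∩ A)` for every prime `𝔓` of `Â`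
(`formallyEquidimensional_quotient_minimalPrimes_of_ringEquiv`). [OURS · L1 W4.2]
[cite: CossartJannsenSaito2020, Lemma 2.37 (2), (2.13)–(2.14)] -/
theorem hsFun_spec_adicCompletion_eq_of_ringEquiv (hA : IsExcellentRing A) {S : Type u} [CommRing S]
    [IsRegularLocalRing S] (I : Ideal S) (e : A ≃+* S ⧸ I) (N : ℕ) (hN : ringKrullDim A ≤ N)
    (x : ↥(Spec (CommRingCat.of (AdicCompletion (maximalIdeal A) A)))) :
    Scheme.hsFun (Spec (CommRingCat.of (AdicCompletion (maximalIdeal A) A))) N x =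
      Scheme.hsFun (Spec (CommRingCat.of A)) N
        ⟨x.asIdeal.comap (algebraMap A (AdicCompletion (maximalIdeal A) A)), inferInstance⟩ :=
  hsFun_spec_adicCompletion_eq A hA (formallyEquidimensional_quotient_minimalPrimes_of_ringEquiv A I e) N hN x

/-- **H8b with `hFE` discharged for quotients of regular local rings** (the form consumed by ROUTE H, whose
local rings are hypersurfaces `R/(h)`, `R` regular local and excellent): for `A ≅ S/I` with `S` regular
local, `A` excellent and `dim A ≤ N`, isolation of the closed point in the `H^N`-maximal locus of `Spec A`
implies isolation of the closed point in the `H^N`-maximal locus of `Spec Â`. [OURS · L1 W4.2]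
[cite: CossartJannsenSaito2020, Lemma 2.37 (2), (2.13)–(2.14)] -/
theorem isIsolatedInHSMaxLocus_adicCompletion_of_ringEquiv (hA : IsExcellentRing A) {S : Type u}
    [CommRing S] [IsRegularLocalRing S] (I : Ideal S) (e : A ≃+* S ⧸ I) (N : ℕ)
    (hN : ringKrullDim A ≤ N) (h : IsIsolatedInHSMaxLocus (Spec (CommRingCat.of A)) N (closedPoint A)) :
    IsIsolatedInHSMaxLocus (Spec (CommRingCat.of (AdicCompletion (maximalIdeal A) A))) N
      (closedPoint (AdicCompletion (maximalIdeal A) A)) :=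
  isIsolatedInHSMaxLocus_adicCompletion A hA (formallyEquidimensional_quotient_minimalPrimes_of_ringEquiv A I e)
    N hN h

end Completion

end Summit.ResolutionOfSingularities.ResolutionOfSingularities.Cruxes.SigmaMaxModifications.IdeasL1C4

end
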